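import Literature.NumberTheory.Automorphic.ThorneQInfinityModularRationalPointsProofs
import Literature.NumberTheory.EllipticCurves.SemistableModPImageProofs
import Literature.NumberTheory.EllipticCurves.SupersingularDensitySerreTraceProofs
import Literature.NumberTheory.EllipticCurves.SerreOpenImageDeterminantProofs
import Literature.NumberTheory.EllipticCurves.RationalIsogenyFrobeniusCriterion
import Literature.NumberTheory.EllipticCurves.ModularCurveManinSemistableCoprimeFormProofs
import Literature.NumberTheory.GaloisRepresentations.ModNCyclotomicCharacter
import Literature.NumberTheory.GaloisRepresentations.FramedRepTwistEulerFactorProofs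
import HarnessLib

/-!
# Thorne 2019, proof of Thm. 5: the mod-`l` representations of 15A1 are onto for `l ≥ 3` — proofs

`Proofs` file (theorems only, nothing is defined, no named fact) discharging the named fact
`Literature.NumberTheory.Automorphic.Thorne2019_surjective_modEll_E₁` of
`ThorneQInfinityModular.lean`: for every prime `l ≥ 3` the mod-`l` Galois representation
`ρ̄_{E₁,l} : Γ_ℚ → Aut(E₁[l])` of Thorne's curve `E₁ = [1, 1, 1, -10, -10]` (Cremona 15A1, a model
of `X₀(15)`) is surjective.

Source READ: J. A. Thorne, *Elliptic curves over `ℚ_∞` are modular*, JEMS 21 (2019), proof of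
Thm. 5 (p. 1945 = arXiv p. 4): "`E` is the curve with Cremona label 15A1 … minimal discriminant
`Δ_E = 15⁴ = 50625` … `ρ_{E,l} : G_ℚ → GL₂(ℤ_l)` is surjective for all primes `l ≥ 3` [by Serre
1972, Prop. 21 and §5.4]" — the printed argument is Serre's criterion for SEMISTABLE curves.  We
follow it in the mod-`l` form the tree states, through the tree's discharged form of that
criterion (`Edixhoven1997_prop_2_1_holds` = Serre 1972, §5.4 Prop. 21 / Edixhoven 1997, Prop. 2.1):
for semistable `E/ℚ`, `ρ̄_{E,l}` is onto unless `E[l]` is reducible with semi-simplification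
`1 ⊕ χ̄_l`.  In the reducible case every `σ ∈ Γ_ℚ` has a non-zero fixed vector in `E[l]`, so
`det(ρ̄(σ) - 1) = 0`, i.e. `tr ρ̄(σ) = 1 + det ρ̄(σ) = 1 + χ̄_l(σ)`; at an arithmetic Frobenius
`σ = Frob_q`, `q ∤ l N_E`, this reads `a_q ≡ 1 + q (mod l)`, i.e. `l ∣ #Ẽ(𝔽_q)` (Serre 1972,
§5.4, proof of Prop. 21 / the standard "`l` divides `#Ẽ(𝔽_q)` for all good `q`").  For 15A1 at
`q = 2`: the equation `[1, 1, 1, -10, -10]` is a global minimal model (`Δ = 3⁴·5⁴` is `12`-th-power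
free), semistable (`gcd(c₄, Δ) = gcd(481, 50625) = 1`, Silverman VII.5.1), with good reduction at
`2` and `#Ẽ₁(𝔽₂) = 4` (the tree's `Thorne2019.natCard_point_F2`), and no prime `l ≥ 3` divides `4`.

Tree inputs (all theorems): `Edixhoven1997_prop_2_1_holds` (`SemistableModPImageProofs`),
`trace_galoisRepTorsion_frobenius_eq` (`SupersingularDensitySerreTraceProofs`: `tr ρ̄_l(Frob_q)
= a_q`), `exists_frame_galoisRepTorsion_rat` (`SerreOpenImageDeterminantProofs`: a frame of `E[l]`
with `det = χ̄_l`), `modNCyclotomicCharacter_eq_residueCard_of_isArithFrobAt`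
(`ModNCyclotomicCharacter`: `χ̄_l(Frob_q) = q`, with `N v = q`,
`FramedRep.residueCard_eq_coe_primesEquiv'`), the integer-model bookkeeping of
`RationalIsogenyFrobeniusCriterion` and `isSemistableAt_of_not_dvd_Δ_or_not_dvd_c₄`
(`ModularCurveManinSemistableCoprimeFormProofs`).

## References

* [Thorne2019] J. A. Thorne, *Elliptic curves over `ℚ_∞` are modular*, J. Eur. Math. Soc. 21
  (2019), 1943–1948, proof of Thm. 5 (p. 1945).
* [Serre1972] J.-P. Serre, *Propriétés galoisiennes des points d'ordre fini des courbes
  elliptiques*, Invent. Math. 15 (1972), §5.4, Prop. 21 and its proof.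
* [Edixhoven1997] B. Edixhoven, *Serre's conjecture*, in Cornell–Silverman–Stevens (1997),
  Prop. 2.1 (PDF p. 285).
* [SilvermanAEC2009] J. H. Silverman, *The Arithmetic of Elliptic Curves*, 2nd ed., VII.1
  Remark 1.1, VII.5 Prop. 5.1.
-/

noncomputable section

open scoped Classical NumberField Matrix
open IsDedekindDomain Field NumberField Rat.HeightOneSpectrum
open WeierstrassCurve Literature.NumberTheory.EllipticCurves
  Literature.NumberTheory.GaloisRepresentations

namespace Literature.NumberTheory.Automorphic

namespace Thorne2019

/-! ### Reducible mod `l` ⟹ every `σ` has a fixed vector ⟹ `tr ρ̄(σ) = 1 + χ̄_l(σ)` -/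

/-- **The reducible alternative of Serre's criterion gives fixed vectors.** For a semistable
elliptic curve `E/ℚ` and a prime `l` with `ρ̄_{E,l}` NOT onto, every `σ ∈ Γ_ℚ` fixes a non-zero
point of `E[l]`: by `Edixhoven1997_prop_2_1_holds` there is a stable line `H ≠ 0, E[l]` fixed
pointwise by `Γ_ℚ` (take any `P ∈ H ∖ 0`) or with `σ • P - P ∈ H` for all `P` (then
`P ↦ σ • P - P` is an endomorphism of the finite group `E[l]` with image in `H ≠ E[l]`, hence not
injective: `σ • (P - Q) = P - Q` for some `P ≠ Q`). [cite: Serre1972, §5.4 Prop. 21]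
[cite: Edixhoven1997, Prop. 2.1 (PDF p. 285)] -/
theorem exists_ne_zero_and_smul_eq_of_not_hasSurjectiveModNGaloisRep (W : WeierstrassCurve ℚ)
    [W.IsElliptic] (hW : W.IsSemistable ℤ) {l : ℕ} (hl : l.Prime)
    (hs : ¬ W.HasSurjectiveModNGaloisRep (l : ℤ)) (σ : absoluteGaloisGroup ℚ) :
    ∃ P : W.geomTorsion (l : ℤ), P ≠ 0 ∧ σ • P = P := by
  rcases Edixhoven1997_prop_2_1_holds W hW l hl with h | ⟨H, -, hbot, htop, hcases⟩
  · exact absurd h hs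
  rcases hcases with hfix | hquot
  · obtain ⟨P, hPH, hP0⟩ := H.bot_or_exists_ne_zero.resolve_left hbot
    exact ⟨P, hP0, hfix σ P hPH⟩
  · haveI : Finite (W.geomTorsion (l : ℤ)) :=
      finite_torsionPoints_holds W (AlgebraicClosure ℚ) (n := (l : ℤ)) (by exact_mod_cast hl.ne_zero)
    have hnsurj : ¬ Function.Surjective (fun P : W.geomTorsion (l : ℤ) ↦ σ • P - P) := by
      intro hsurj
      apply htop
      rw [AddSubgroup.eq_top_iff']
      intro Q
      obtain ⟨P, rfl⟩ := hsurj Q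
      exact hquot σ P
    have hninj : ¬ Function.Injective (fun P : W.geomTorsion (l : ℤ) ↦ σ • P - P) := fun hinj ↦
      hnsurj (Finite.injective_iff_surjective.mp hinj)
    obtain ⟨P, Q, hPQ, hne⟩ := Function.not_injective_iff.mp hninj
    refine ⟨P - Q, sub_ne_zero.mpr hne, ?_⟩
    rw [smul_sub]
    exact sub_eq_sub_iff_sub_eq_sub.mp hPQ

/-- `2 × 2` linear algebra: a matrix with a non-zero fixed vector has `det M - tr M + 1 = 0`
(`= det (M - 1)`, the characteristic polynomial at `1`). [folklore] -/
theorem det_sub_trace_add_one_eq_zero {F : Type*} [Field F] {M : Matrix (Fin 2) (Fin 2) F}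
    {x : Fin 2 → F} (hx : x ≠ 0) (hM : M *ᵥ x = x) : M.det - M.trace + 1 = 0 := by
  have h0 : (M - 1) *ᵥ x = 0 := by rw [Matrix.sub_mulVec, Matrix.one_mulVec, hM, sub_self]
  have hdet : (M - 1).det = 0 := Matrix.exists_mulVec_eq_zero_iff.mp ⟨x, hx, h0⟩
  rw [Matrix.det_fin_two] at hdet
  simp only [Matrix.sub_apply, Matrix.one_apply_eq, ne_eq, zero_ne_one, not_false_eq_true,
    Matrix.one_apply_ne, one_ne_zero, sub_zero] at hdet
  rw [Matrix.det_fin_two, Matrix.trace_fin_two]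
  linear_combination hdet

/-- **`tr ρ̄_{E,l}(σ) = 1 + χ̄_l(σ)` when `σ` fixes a non-zero point of `E[l]`** (`E/ℚ` an
elliptic curve, `l` prime): in a frame `E[l] ≅ 𝔽_l²` (`exists_frame_galoisRepTorsion_rat`, with
`det = χ̄_l` by the Weil pairing) the matrix `M` of `σ` has the fixed vector `e P ≠ 0`, so
`det M - tr M + 1 = 0`. This is the trace identity behind "semi-simplification `1 ⊕ χ_l`"
(Serre 1972, §5.4). [cite: Serre1972, §5.4 Prop. 21 (proof)] -/
theorem trace_galoisRepTorsion_eq_one_add_of_smul_eq (W : WeierstrassCurve ℚ) [W.IsElliptic]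
    (l : ℕ) [Fact l.Prime] (σ : absoluteGaloisGroup ℚ) {P : W.geomTorsion (l : ℤ)} (hP0 : P ≠ 0)
    (hP : σ • P = P) :
    letI : Module (ZMod l) (W.geomTorsion l) := AddSubgroup.torsionBy.zmodModule
    LinearMap.trace (ZMod l) (W.geomTorsion l)
        ((W.galoisRepTorsion l σ).toAdd.toAddMonoidHom.toZModLinearMap l) =
      1 + ((modPCyclotomicCharacterZMod ℚ l σ : (ZMod l)ˣ) : ZMod l) := by
  letI : Module (ZMod l) (W.geomTorsion l) := AddSubgroup.torsionBy.zmodModule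
  obtain ⟨e, Φ, he, htr, hdet, -, -⟩ := exists_frame_galoisRepTorsion_rat W l
  have hx : e P ≠ 0 := fun h ↦ hP0 (e.map_eq_zero_iff.mp h)
  have hMx : ((Φ (W.galoisRepTorsion l σ) : GL (Fin 2) (ZMod l)) :
      Matrix (Fin 2) (Fin 2) (ZMod l)) *ᵥ e P = e P := by
    rw [← he]
    show e (σ • P) = e P
    rw [hP]
  have key := det_sub_trace_add_one_eq_zero hx hMx
  rw [htr, ← Matrix.GeneralLinearGroup.val_det_apply, hdet σ] at key
  -- key : χ - tr + 1 = 0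
  linear_combination -key

/-! ### Frobenius values over `ℚ`: `N v = p` and `χ̄_l(Frob_p) = p` -/

/-- **`χ̄_l(Frob_p) = p (mod l)`** for primes `p ≠ l`, a prime `𝔓` of `\bar ℤ` above `p` and an
arithmetic Frobenius `σ` at `𝔓` (the tree's `modNCyclotomicCharacter_eq_residueCard_of_isArithFrobAt`
with `N v = p` and `l ∉ 𝔓`). [folklore] -/
theorem coe_modPCyclotomicCharacterZMod_of_isArithFrobAt (l : ℕ) [Fact l.Prime] {p : ℕ}
    (hp : p.Prime) (hpl : p ≠ l) {v : HeightOneSpectrum (𝓞 ℚ)}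
    (hv : ((primesEquiv v : Nat.Primes) : ℕ) = p) {𝔓 : Ideal (absIntegers (𝓞 ℚ) ℚ)}
    (h𝔓 : 𝔓 ∈ v.primesAbove) {σ : absoluteGaloisGroup ℚ} (hσ : IsArithFrobAt (𝓞 ℚ) σ 𝔓) :
    ((modPCyclotomicCharacterZMod ℚ l σ : (ZMod l)ˣ) : ZMod l) = p := by
  have hl : l.Prime := Fact.out
  haveI : NeZero (l : ℚ) := ⟨Nat.cast_ne_zero.mpr hl.ne_zero⟩
  haveI : NeZero l := ⟨hl.ne_zero⟩
  have hN : (l : absIntegers (𝓞 ℚ) ℚ) ∉ 𝔓 := by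
    refine Rat.natCast_not_mem_of_mem_primesAbove_of_not_dvd h𝔓 ?_
    rw [hv]
    intro h
    exact hpl ((Nat.prime_dvd_prime_iff_eq hp hl).mp h)
  rw [modPCyclotomicCharacterZMod_eq_modNCyclotomicCharacter,
    modNCyclotomicCharacter_eq_residueCard_of_isArithFrobAt h𝔓 hN hσ,
    FramedRep.residueCard_eq_coe_primesEquiv', hv]

/-! ### Integer models: semistability from `gcd(c₄, Δ) = 1` -/

/-- **`gcd(c₄, Δ) = 1` ⟹ semistable** for an integer equation `E₀` of an elliptic curve over `ℚ`:
at each prime `p`, `p ∤ Δ` or `p ∤ c₄`, hence good or multiplicative reduction (Silverman, AEC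
VII.5, Prop. 5.1 (a),(b) with VII.1 Remark 1.1; the tree's
`isSemistableAt_of_not_dvd_Δ_or_not_dvd_c₄`). [cite: SilvermanAEC2009, VII.5 Prop. 5.1 (PDF p. 174)] -/
theorem isSemistable_baseChange_int_of_isCoprime (E₀ : WeierstrassCurve ℤ)
    [(E₀.baseChange ℚ).IsElliptic] (hcop : IsCoprime E₀.c₄ E₀.Δ) :
    (E₀.baseChange ℚ).IsSemistable ℤ := by
  intro v
  refine isSemistableAt_of_not_dvd_Δ_or_not_dvd_c₄ E₀ ?_
  have h := (Int.isCoprime_iff_forall_prime_not_dvd _ _).mp hcop (natGenerator v)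
    (prime_natGenerator v)
  tauto

/-! ### Serre's criterion read on an explicit integer model -/

/-- **Surjectivity of `ρ̄_{E,l}` from one good Frobenius** (Serre 1972, §5.4, proof of Prop. 21,
for an explicit equation). Let `E₀ = [a₁, a₂, a₃, a₄, a₆]` be an integer Weierstrass equation
with `p¹² ∤ Δ` or `p ∤ c₄` at every prime (a global minimal model) and `gcd(c₄, Δ) = 1`
(semistable), `q ∤ Δ` a prime (good reduction) and `l ≠ q` a prime with `l ∤ #(E₀ mod q)(𝔽_q)`.
Then `ρ̄_{E₀ ⊗ ℚ, l}` is onto `Aut(E[l])`: otherwise (Serre's criterion,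
`exists_ne_zero_and_smul_eq_of_not_hasSurjectiveModNGaloisRep`) an arithmetic Frobenius `σ` at
`q` fixes a non-zero vector of `E[l]`, so `a_q = tr ρ̄(σ) = 1 + χ̄_l(σ) = 1 + q (mod l)`
(`trace_galoisRepTorsion_frobenius_eq`, `trace_galoisRepTorsion_eq_one_add_of_smul_eq`,
`coe_modPCyclotomicCharacterZMod_of_isArithFrobAt`), i.e. `l ∣ q + 1 - a_q = #Ẽ(𝔽_q)`.
[cite: Serre1972, §5.4 Prop. 21] [cite: Thorne2019, proof of Thm. 5 (p. 1945)] -/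
theorem hasSurjectiveModNGaloisRep_baseChange_int_of_not_dvd_card (E₀ : WeierstrassCurve ℤ)
    (hmin : ∀ p : ℕ, p.Prime → ¬ ((p : ℤ) ^ 12 ∣ E₀.Δ) ∨ ¬ ((p : ℤ) ∣ E₀.c₄))
    (hcop : IsCoprime E₀.c₄ E₀.Δ) {q : ℕ} [Fact q.Prime] (hqΔ : ¬ ((q : ℤ) ∣ E₀.Δ))
    {l : ℕ} [Fact l.Prime] (hql : q ≠ l)
    (hcard : ¬ l ∣ Nat.card ((E₀.map (Int.castRingHom (ZMod q))).toAffine.Point)) :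
    (E₀.baseChange ℚ).HasSurjectiveModNGaloisRep (l : ℤ) := by
  have hq : q.Prime := Fact.out
  have hl : l.Prime := Fact.out
  have hΔ : E₀.Δ ≠ 0 := fun h ↦ hqΔ (h ▸ dvd_zero _)
  haveI : (E₀.baseChange ℚ).IsElliptic := isElliptic_baseChange_int E₀ hΔ
  haveI : (E₀.baseChange ℚ).IsGloballyMinimal := isGloballyMinimal_baseChange_int E₀ hmin
  by_contra hs
  -- an arithmetic Frobenius `σ` at a prime `𝔓` of `\bar ℤ` above `q`
  set v : HeightOneSpectrum (𝓞 ℚ) := (primesEquiv (R := 𝓞 ℚ)).symm ⟨q, hq⟩ with hv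
  have hvq : ((primesEquiv v : Nat.Primes) : ℕ) = q := by rw [hv, Equiv.apply_symm_apply]
  obtain ⟨𝔓, h𝔓⟩ := v.primesAbove_nonempty
  obtain ⟨σ, hσ⟩ := HeightOneSpectrum.exists_isArithFrobAt_of_mem_primesAbove_holds h𝔓
  -- `σ` fixes a non-zero point of `E[l]`
  obtain ⟨P, hP0, hP⟩ := exists_ne_zero_and_smul_eq_of_not_hasSurjectiveModNGaloisRep _
    (isSemistable_baseChange_int_of_isCoprime E₀ hcop) hl hs σ
  -- the trace of `σ` on `E[l]`, two ways
  have h1 := trace_galoisRepTorsion_eq_one_add_of_smul_eq (E₀.baseChange ℚ) l σ hP0 hP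
  have h2 := trace_galoisRepTorsion_frobenius_eq (E₀.baseChange ℚ) l hql
    (hasGoodReductionAtPrime_baseChange_int E₀ q hqΔ) hvq h𝔓 hσ
  have h := h1.symm.trans h2
  rw [coe_modPCyclotomicCharacterZMod_of_isArithFrobAt l hq hql hvq h𝔓 hσ,
    frobeniusTrace_baseChange_int E₀ rfl] at h
  push_cast at h
  have key : ((Nat.card ((E₀.map (Int.castRingHom (ZMod q))).toAffine.Point) : ℕ) : ZMod l) = 0 := by
    linear_combination h
  exact hcard ((ZMod.natCast_eq_zero_iff _ _).mp key)

/-! ### The curve 15A1 -/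

/-- `Δ([1, 1, 1, -10, -10]) = 50625 = 3⁴ · 5⁴`. [cite: Thorne2019, proof of Thm. 5 (p. 1945)] -/
theorem fifteenA1_int_Δ : (⟨1, 1, 1, -10, -10⟩ : WeierstrassCurve ℤ).Δ = 50625 := by
  norm_num [WeierstrassCurve.Δ, WeierstrassCurve.b₂, WeierstrassCurve.b₄, WeierstrassCurve.b₆,
    WeierstrassCurve.b₈]

/-- `c₄([1, 1, 1, -10, -10]) = 481 = 13 · 37`. [folklore] -/
theorem fifteenA1_int_c₄ : (⟨1, 1, 1, -10, -10⟩ : WeierstrassCurve ℤ).c₄ = 481 := by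
  norm_num [WeierstrassCurve.c₄, WeierstrassCurve.b₂, WeierstrassCurve.b₄]

/-- Thorne's `E₁` is the base change of the integer equation `[1, 1, 1, -10, -10]`. [folklore] -/
theorem baseChange_fifteenA1_int :
    (⟨1, 1, 1, -10, -10⟩ : WeierstrassCurve ℤ).baseChange ℚ = E₁ := by
  rw [baseChange_int_eq_map]
  ext <;> simp [WeierstrassCurve.map, E₁]

/-- The reduction of `[1, 1, 1, -10, -10]` modulo `2` is `[1, 1, 1, 0, 0]`. [folklore] -/
theorem map_fifteenA1_int_zmod_two :
    (⟨1, 1, 1, -10, -10⟩ : WeierstrassCurve ℤ).map (Int.castRingHom (ZMod 2)) = ⟨1, 1, 1, 0, 0⟩ := by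
  ext <;> simp [WeierstrassCurve.map] <;> decide

end Thorne2019

open Thorne2019 in
/-- **Thorne 2019, proof of Thm. 5: `ρ̄_{E₁,l}` is onto for every prime `l ≥ 3`** — discharge of
the named fact `Thorne2019_surjective_modEll_E₁`. The equation `E₁ = [1, 1, 1, -10, -10]` of 15A1
is a global minimal model (`Δ = 15⁴` is `12`-th-power free), semistable (`gcd(c₄, Δ) =
gcd(481, 15⁴) = 1`), with good reduction at `2` and `#Ẽ₁(𝔽₂) = 4` (`natCard_point_F2`); a prime
`l ≥ 3` does not divide `4`, so Serre's criterion
(`hasSurjectiveModNGaloisRep_baseChange_int_of_not_dvd_card` at `q = 2`) gives surjectivity.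
[cite: Thorne2019, proof of Thm. 5 (p. 1945)] [cite: Serre1972, §5.4 Prop. 21] -/
theorem Thorne2019_surjective_modEll_E₁_holds : Thorne2019_surjective_modEll_E₁ := by
  intro l hl h3
  haveI : Fact l.Prime := ⟨hl⟩
  rw [← baseChange_fifteenA1_int]
  refine hasSurjectiveModNGaloisRep_baseChange_int_of_not_dvd_card _ ?_ ?_ (q := 2) ?_ ?_ ?_
  · refine forall_not_pow_dvd_or_of_bound _ (B := 3) ?_ ?_ ?_
    · rw [fifteenA1_int_Δ]; decide
    · rw [fifteenA1_int_Δ]; decide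
    · rw [fifteenA1_int_Δ, fifteenA1_int_c₄]; decide
  · rw [fifteenA1_int_Δ, fifteenA1_int_c₄]; norm_num
  · rw [fifteenA1_int_Δ]; decide
  · omega
  · rw [map_fifteenA1_int_zmod_two, natCard_point_F2 _ rfl]
    intro h4
    have h2 : l ∣ 2 := hl.dvd_of_dvd_pow (show l ∣ 2 ^ 2 from h4)
    have := (Nat.prime_dvd_prime_iff_eq hl Nat.prime_two).mp h2
    omega

end Literature.NumberTheory.Automorphic

end
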